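import Mathlib.FieldTheory.Separable
import Mathlib.FieldTheory.IsAlgClosed.Basic
import Mathlib.Analysis.Complex.Polynomial.Basic
import Mathlib.LinearAlgebra.FiniteDimensional.Defs
import Mathlib.LinearAlgebra.Dimension.Finrank
import Mathlib.NumberTheory.Padics.PadicNumbers
import Mathlib.Analysis.Complex.Basic
import Mathlib.CategoryTheory.Functor.Basic
import Mathlib.CategoryTheory.IsConnected
import Mathlib.CategoryTheory.Comma.Over.Basic
import Literature.AlgebraicGeometry.Frobenioids.Categories
import Literature.AlgebraicGeometry.Frobenioids.CategoriesFactorization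
import HarnessLib

/-!
# Frobenioids II, §1/§3: the base categories `D₀` of finite étale coverings; Definition 3.1 (v)

Mochizuki, *The geometry of Frobenioids II*, Kyushu J. Math. **62** (2008) 401–460.
* §1 p. 7: "write `D₀` for the full subcategory of connected objects of the Galois category of finite
  étale coverings of `Spec(ℚ_p)`. Thus, `D₀` is a connected, totally epimorphic category, which is of
  FSM-, hence also of FSMFF-type" [cite: MochizukiFrdII2008, §1 p.7];
* §3 p. 23: the same with `Spec(ℝ)` [cite: MochizukiFrdII2008, §3 p.23];
* §3 Definition 3.1 (v), pp. 24–25: real / complex objects of a category `F → D₀`, `F[ℝ]`, `F[ℂ]`,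
  real / complex / complexifiable / RC-connected `F`, RC-anchors, RC-subanchors, RC-iso-subanchors,
  RC-iso-subanchor type, RC-standard type [cite: MochizukiFrdII2008, Def 3.1 (v) pp.24-25].

**Model of `D₀`.** For a field `F`, a connected finite étale covering of `Spec F` is `Spec K` for a
finite separable field extension `K/F`, and a morphism `Spec K → Spec L` over `F` is an `F`-algebra
homomorphism `L → K`. We take this as the definition: `FinEtale F` has objects the bundled finite
separable extensions and `Hom (Spec K) (Spec L) := (L →ₐ[F] K)` (wrapped in a structure). `D₀` of §1
is `FinEtale ℚ_[p]`, `D₀` of §3 is `FinEtale ℝ` (whose objects are real, `[K:ℝ] = 1`, or complex,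
`[K:ℝ] = 2`). Claims: `D₀` is connected (PROVED: every object maps to `Spec F`) and totally
epimorphic (PROVED: field homomorphisms are injective); "of FSM-type" is a named fact for the two
printed bases `ℚ_p` and `ℝ` (its proof is Galois theory: a monomorphism of `FinEtale F` is already an
isomorphism by separability), "hence FSMFF" is `IsOfFSMType.isOfFSMFFType`; every object over `ℝ` is
real or complex (PROVED).
-/

namespace Literature.AlgebraicGeometry.Frobenioids

open CategoryTheory

universe v' u' u

/-! ### The category `FinEtale F` of connected finite étale coverings of `Spec F` -/

/-- A connected finite étale covering `Spec K → Spec F`: a finite separable field extension `K/F`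
(FrdII §1 p. 7 / §3 p. 23, the objects of `D₀`). [cite: MochizukiFrdII2008, §1 p.7] -/
structure FinEtale (F : Type u) [Field F] : Type (u + 1) where
  /-- the field `K` of the covering `Spec K` -/
  carrier : Type u
  [field : Field carrier]
  [algebra : Algebra F carrier]
  [finiteDimensional : FiniteDimensional F carrier]
  [isSeparable : Algebra.IsSeparable F carrier]

namespace FinEtale

attribute [instance] FinEtale.field FinEtale.algebra FinEtale.finiteDimensional FinEtale.isSeparable

variable {F : Type u} [Field F]

/-- An object `Spec K` is used as the type `K`. [cite: MochizukiFrdII2008, §1 p.7] -/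
instance : CoeSort (FinEtale F) (Type u) := ⟨FinEtale.carrier⟩

/-- A morphism `Spec K → Spec L` of `D₀`: an `F`-algebra homomorphism `L → K` (FrdII §1 p. 7).
[cite: MochizukiFrdII2008, §1 p.7] -/
@[ext] structure Hom (X Y : FinEtale F) : Type u where
  /-- the underlying `F`-algebra homomorphism, in the opposite direction -/
  alg : Y →ₐ[F] X

/-- `D₀ = FinEtale F` is a category (composition = composition of algebra maps, reversed).
[cite: MochizukiFrdII2008, §1 p.7] -/
instance instCategory : Category (FinEtale F) where
  Hom := Hom
  id X := ⟨AlgHom.id F X⟩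
  comp f g := ⟨f.alg.comp g.alg⟩

/-- Extensionality for morphisms of `D₀`. [cite: MochizukiFrdII2008, §1 p.7] -/
@[ext] theorem hom_ext {X Y : FinEtale F} {f g : X ⟶ Y} (h : f.alg = g.alg) : f = g := Hom.ext h

/-- The underlying algebra map of a composite. [cite: MochizukiFrdII2008, §1 p.7] -/
@[simp] theorem comp_alg {X Y Z : FinEtale F} (f : X ⟶ Y) (g : Y ⟶ Z) : (f ≫ g).alg = f.alg.comp g.alg := rfl

/-- The underlying algebra map of the identity. [cite: MochizukiFrdII2008, §1 p.7] -/
@[simp] theorem id_alg (X : FinEtale F) : (𝟙 X : X ⟶ X).alg = AlgHom.id F X := rfl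

variable (F) in
/-- `Spec F` itself, the final object of `D₀`. [cite: MochizukiFrdII2008, §1 p.7] -/
def base : FinEtale F := ⟨F⟩

/-- Every object `Spec K` maps to `Spec F` (the structure map). [cite: MochizukiFrdII2008, §1 p.7] -/
def toBase (X : FinEtale F) : X ⟶ base F := ⟨Algebra.ofId F X⟩

/-- "`D₀` is … connected" (FrdII §1 p. 7 / §3 p. 23) — PROVED: all objects map to `Spec F`.
[cite: MochizukiFrdII2008, §1 p.7] -/
theorem isConnected : IsConnected (FinEtale F) := by
  haveI : Nonempty (FinEtale F) := ⟨base F⟩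
  refine zigzag_isConnected fun X Y => ?_
  exact (Zigzag.of_hom (toBase X)).trans (Zigzag.of_inv (toBase Y))

/-- "`D₀` is … totally epimorphic" (FrdII §1 p. 7 / §3 p. 23) — PROVED: an `F`-algebra map of fields
`L → K` is injective, so `Spec K → Spec L` is an epimorphism. [cite: MochizukiFrdII2008, §1 p.7] -/
theorem isTotallyEpimorphic : IsTotallyEpimorphic (FinEtale F) := by
  refine ⟨fun {X Y} f => ⟨fun {Z} g h hgh => ?_⟩⟩
  apply hom_ext
  apply AlgHom.ext
  intro z
  have := congrArg (fun k : X ⟶ Z => k.alg z) hgh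
  simp only [comp_alg, AlgHom.coe_comp, Function.comp_apply] at this
  exact f.alg.toRingHom.injective this

end FinEtale

/-- `D₀` of §1: connected finite étale coverings of `Spec(ℚ_p)` (FrdII §1 p. 7).
[cite: MochizukiFrdII2008, §1 p.7] -/
abbrev PadicBase (p : ℕ) [Fact p.Prime] : Type 1 := FinEtale ℚ_[p]

/-- `D₀` of §3: connected finite étale coverings of `Spec(ℝ)` (FrdII §3 p. 23).
[cite: MochizukiFrdII2008, §3 p.23] -/
abbrev ArchBase : Type 1 := FinEtale ℝ

/-- "`D₀` [over `ℚ_p`] … is of FSM-type" (FrdII §1 p. 7): fiberwise-surjective monomorphisms of `D₀` are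
isomorphisms ("hence also of FSMFF-type" is `IsOfFSMType.isOfFSMFFType`).
[cite: MochizukiFrdII2008, §1 p.7] -/
def PadicBase.IsOfFSMTypeFact (p : ℕ) [Fact p.Prime] : Prop := IsOfFSMType (PadicBase p)

/-- "`D₀` [over `ℝ`] … is of FSM-, hence also of FSMFF-type" (FrdII §3 p. 23).
[cite: MochizukiFrdII2008, §3 p.23] -/
def ArchBase.IsOfFSMTypeFact : Prop := IsOfFSMType ArchBase

namespace FinEtale

/-- "hence also of FSMFF-type" (FrdII §1 p. 7 / §3 p. 23) — from FSM-type, for any base field.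
[cite: MochizukiFrdII2008, §1 p.7] -/
theorem isOfFSMFFType_of {F : Type u} [Field F] (h : IsOfFSMType (FinEtale F)) :
    IsOfFSMFFType (FinEtale F) := h.isOfFSMFFType

end FinEtale

/-! ### Definition 3.1 (v): real and complex objects (pp. 24–25) -/

namespace ArchBase

/-- An object `Spec K` of `D₀` (over `ℝ`) is *real* if `K` is a real archimedean local field, i.e.
`[K : ℝ] = 1` (FrdII Def. 3.1 (v), p. 24). [cite: MochizukiFrdII2008, Def 3.1 (v) p.24] -/
def IsReal (X : ArchBase) : Prop := Module.finrank ℝ X = 1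

/-- An object `Spec K` of `D₀` (over `ℝ`) is *complex* if `K` is a complex archimedean local field,
i.e. `[K : ℝ] = 2` (FrdII Def. 3.1 (v), p. 24). [cite: MochizukiFrdII2008, Def 3.1 (v) p.24] -/
def IsComplex (X : ArchBase) : Prop := Module.finrank ℝ X = 2

/-- Every object of `D₀` over `ℝ` is real or complex: a finite extension `K/ℝ` embeds into the
algebraic closure `ℂ`, so `1 ≤ [K:ℝ] ≤ 2` (the dichotomy behind FrdII Def. 3.1 (i), p. 23).
[cite: MochizukiFrdII2008, Def 3.1 (i) p.23] -/
theorem isReal_or_isComplex (X : ArchBase) : IsReal X ∨ IsComplex X := by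
  let f : X →ₐ[ℝ] ℂ := IsAlgClosed.lift
  have hinj : Function.Injective f.toLinearMap := f.toRingHom.injective
  have h2 : Module.finrank ℝ X ≤ 2 := by
    have h := LinearMap.finrank_le_finrank_of_injective hinj
    rwa [Complex.finrank_real_complex] at h
  have h1 : 0 < Module.finrank ℝ X := Module.finrank_pos
  unfold IsReal IsComplex
  omega

end ArchBase

namespace RC

variable {𝓕 : Type u'} [Category.{v'} 𝓕] (P : 𝓕 ⥤ ArchBase)

/-- `F[ℝ]`: the object property "projects to a real object of `D₀`" (FrdII Def. 3.1 (v), p. 24).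
[cite: MochizukiFrdII2008, Def 3.1 (v) p.24] -/
def realObjects : ObjectProperty 𝓕 := fun A => ArchBase.IsReal (P.obj A)

/-- `F[ℂ]`: the object property "projects to a complex object of `D₀`" (FrdII Def. 3.1 (v), p. 24).
[cite: MochizukiFrdII2008, Def 3.1 (v) p.24] -/
def complexObjects : ObjectProperty 𝓕 := fun A => ArchBase.IsComplex (P.obj A)

/-- `F[ℝ] ⊆ F`, the full subcategory of real objects (FrdII Def. 3.1 (v), p. 24).
[cite: MochizukiFrdII2008, Def 3.1 (v) p.24] -/
abbrev RealPart : Type u' := (realObjects P).FullSubcategory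

/-- `F[ℂ] ⊆ F`, the full subcategory of complex objects (FrdII Def. 3.1 (v), p. 24).
[cite: MochizukiFrdII2008, Def 3.1 (v) p.24] -/
abbrev ComplexPart : Type u' := (complexObjects P).FullSubcategory

/-- "If `F = F[ℝ]` …, then we shall say that `F` is *real*" (FrdII Def. 3.1 (v), pp. 24–25).
[cite: MochizukiFrdII2008, Def 3.1 (v) pp.24-25] -/
@[mk_iff] structure IsRealCat : Prop where
  /-- every object is real -/
  real : ∀ A : 𝓕, realObjects P A

/-- "If … `F = F[ℂ]`, then we shall say that `F` is *complex*" (FrdII Def. 3.1 (v), pp. 24–25).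
[cite: MochizukiFrdII2008, Def 3.1 (v) pp.24-25] -/
@[mk_iff] structure IsComplexCat : Prop where
  /-- every object is complex -/
  complex : ∀ A : 𝓕, complexObjects P A

/-- `F` is *complexifiable* (FrdII Def. 3.1 (v), p. 25): "for every `A ∈ Ob(F[ℝ])`, there exists a
morphism `B → A` in `F`, where `B ∈ Ob(F[ℂ])`, together with an automorphism `β ∈ Aut_{F_A}(B)` that
projects to the unique nontrivial automorphism of `D₀`" (an automorphism of `B` over `A` whose image in
`D₀` is not the identity). [cite: MochizukiFrdII2008, Def 3.1 (v) p.25] -/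
@[mk_iff] structure IsComplexifiable : Prop where
  /-- every real object receives a complex object with a lift of complex conjugation over it -/
  exists_complex : ∀ A : 𝓕, realObjects P A → ∃ (B : 𝓕) (f : B ⟶ A) (β : B ≅ B),
    complexObjects P B ∧ β.hom ≫ f = f ∧ P.map β.hom ≠ 𝟙 (P.obj B)

/-- `F` is *RC-connected* (FrdII Def. 3.1 (v), p. 25): "`F` is connected, and, moreover, the categories
`F[ℝ]`, `F[ℂ]` are either empty or connected." [cite: MochizukiFrdII2008, Def 3.1 (v) p.25] -/
@[mk_iff] structure IsRCConnected : Prop where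
  /-- `F` is connected -/
  isConnected : IsConnected 𝓕
  /-- `F[ℝ]` is empty or connected -/
  real : IsEmpty (RealPart P) ∨ IsConnected (RealPart P)
  /-- `F[ℂ]` is empty or connected -/
  complex : IsEmpty (ComplexPart P) ∨ IsConnected (ComplexPart P)

/-- An *RC-anchor* (FrdII Def. 3.1 (v), p. 25; `F` totally epimorphic): "`A` determines an anchor of
`F[ℂ]`" — `A` is complex and an anchor of the full subcategory `F[ℂ]`.
[cite: MochizukiFrdII2008, Def 3.1 (v) p.25] -/
def IsRCAnchor (A : 𝓕) : Prop := ∃ h : complexObjects P A, IsAnchor (⟨A, h⟩ : ComplexPart P)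

/-- An *RC-subanchor* (FrdII Def. 3.1 (v), p. 25): "there exists a morphism `A → B` in `F`, where `B` is
an RC-anchor." [cite: MochizukiFrdII2008, Def 3.1 (v) p.25] -/
def IsRCSubanchor (A : 𝓕) : Prop := ∃ B : 𝓕, IsRCAnchor P B ∧ Nonempty (A ⟶ B)

/-- An *RC-iso-subanchor* (FrdII Def. 3.1 (v), p. 25): "there exist an RC-subanchor `B ∈ Ob(F)`, a
subgroup `G ⊆ Aut_F(B)`, and a morphism `B → A` in `F` which is a mono-minimal categorical quotient in
`F` of `B` by `G`." [cite: MochizukiFrdII2008, Def 3.1 (v) p.25] -/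
def IsRCIsoSubanchor (A : 𝓕) : Prop :=
  ∃ (B : 𝓕) (G : Subgroup (Aut B)) (f : B ⟶ A), IsRCSubanchor P B ∧ IsMonoMinimalQuotient G f

/-- `F` is *of RC-iso-subanchor type* (FrdII Def. 3.1 (v), p. 25): every object is an RC-iso-subanchor.
[cite: MochizukiFrdII2008, Def 3.1 (v) p.25] -/
@[mk_iff] structure IsOfRCIsoSubanchorType : Prop where
  /-- every object is an RC-iso-subanchor -/
  isRCIsoSubanchor : ∀ A : 𝓕, IsRCIsoSubanchor P A

/-- `F` is *of RC-standard type* (FrdII Def. 3.1 (v), p. 25): "(a) RC-connected; (b) complexifiable;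
(c) of FSMFF-type; (d) of RC-iso-subanchor type", for "[the totally epimorphic category] `F`"
(recorded as the field `totallyEpimorphic`).
[cite: MochizukiFrdII2008, Def 3.1 (v) p.25] -/
structure IsOfRCStandardType : Prop where
  /-- the standing hypothesis "[the totally epimorphic category] `F`" -/
  totallyEpimorphic : IsTotallyEpimorphic 𝓕
  /-- (a) RC-connected -/
  rcConnected : IsRCConnected P
  /-- (b) complexifiable -/
  complexifiable : IsComplexifiable P
  /-- (c) of FSMFF-type -/
  fsmff : IsOfFSMFFType 𝓕
  /-- (d) of RC-iso-subanchor type -/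
  rcIsoSubanchor : IsOfRCIsoSubanchorType P

end RC

end Literature.AlgebraicGeometry.Frobenioids
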